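import Literature.AlgebraicGeometry.Modules.SerreTwist
import HarnessLib

/-!
# Serre's twisting sheaves `𝒪_Z(-m)`: chart identities and the local generators

Continuation of `Literature/AlgebraicGeometry/Modules/SerreTwist` (`serreTwist ι m : Z.Modules` for
`ι : Z ⟶ 𝐏ʳ_A`). This file proves the identities between the chart functions `x_i / x_j ∈ Γ(Z, Z_j)`
that hold in the Laurent ring and are transported to `Z` by the evaluation maps
`ProjCech.evalRing` on the common chart `Z_j ∩ Z_{j'} = Z_{{j,j'}}`:

* `Dplus_union`, `Zop_union` — `D₊(X_{s ∪ t}) = D₊(X_s) ∩ D₊(X_t)`, hence `Z_{s ∪ t} = Z_s ∩ Z_t`;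
* `chartFun_cocycle` — `x_i / x_j = (x_i / x_{j'}) · (x_{j'} / x_j)` on `Z_j ∩ Z_{j'}`, and
  `chartFun_mul_symm` — `(x_j / x_{j'}) · (x_{j'} / x_j) = 1`;
* `wordFun_cocycle` — `μ_w / x_j^m = (μ_w / x_{j'}^m) · (x_{j'} / x_j)^m`, and the key symmetric
  identity `wordFun_mul_comm` — `(μ_w / x_j^m)(μ_{w'} / x_{j'}^m) = (μ_{w'} / x_j^m)(μ_w / x_{j'}^m)`;
* `isTwistSection_mul_wordFun` — for `c ∈ Γ(Z, V)`, `V ⊆ Z_j`, the family `(c · μ_w / x_j^m)_w` is a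
  section of `𝒪_Z(-m)`; in particular THE LOCAL GENERATOR `gen ι m j ∈ Γ(Z_j, 𝒪_Z(-m))`,
  `(gen)_w = μ_w / x_j^m`, with `gen ι m j = (x_{j'}/x_j)^m · gen ι m j'` on the overlap
  (`gen_restrict_eq_smul_gen`: the transition functions of `𝒪(-m)`);
* `coeff_eq_coeff_const_mul` — every section over `V ⊆ Z_j` is `f_{j⋯j} · gen_j`
  (`eq_smul_gen`), so `f ↦ f_{j⋯j}` is injective on `Γ(V, 𝒪_Z(-m))` (`coeff_const_injective`).

The packaging of these as trivialisations `𝒪_{Z_j} ≅ 𝒪_Z(-m)|_{Z_j}` in Mathlib's language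
(`SheafOfModules.free`, `IsFiniteLocallyFree`) is in `Modules/SerreTwistTrivial`.

References: Hartshorne II Prop. 5.12 (transition functions of `𝒪(n)`); EGA II 2.5.
-/

noncomputable section

universe u

open CategoryTheory AlgebraicGeometry TopologicalSpace Opposite
open Literature.Algebra.Homology Literature.Algebra.Homology.LaurentCech
open Literature.AlgebraicGeometry.Morphisms Literature.AlgebraicGeometry.Morphisms.ProjCech

attribute [local instance] MvPolynomial.gradedAlgebra
  Literature.AlgebraicGeometry.Motives.ProjBaseChange.algebraBase

namespace Literature.AlgebraicGeometry.Modules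

namespace SerreTwist

variable {A : Type u} [CommRing A] {r : ℕ} {Z : Scheme.{u}} (ι : Z ⟶ PP A r)

/-! ## Unions of charts -/

omit ι in
/-- `D₊(X_{s ∪ t}) = D₊(X_s) ∩ D₊(X_t)` (`X_s X_t = X_{s∪t} X_{s∩t}`). [folklore] -/
theorem Dplus_union (s t : Finset (Fin (r + 1))) : Dplus A r (s ∪ t) = Dplus A r s ⊓ Dplus A r t := by
  apply le_antisymm (le_inf (Dplus_mono Finset.subset_union_left) (Dplus_mono Finset.subset_union_right))
  have h : Xs A s * Xs A t = Xs A (s ∪ t) * Xs A (s ∩ t) := by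
    rw [Xs, Xs, Xs, Xs, Finset.prod_union_inter]
  calc Dplus A r s ⊓ Dplus A r t = Proj.basicOpen (grading A r) (Xs A s * Xs A t) :=
        (Proj.basicOpen_mul _ _ _).symm
    _ = Dplus A r (s ∪ t) ⊓ Dplus A r (s ∩ t) := by rw [h]; exact Proj.basicOpen_mul _ _ _
    _ ≤ Dplus A r (s ∪ t) := inf_le_left

/-- `Z_{s ∪ t} = Z_s ∩ Z_t`. [folklore] -/
theorem Zop_union (s t : Finset (Fin (r + 1))) : Zop ι (s ∪ t) = Zop ι s ⊓ Zop ι t := by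
  simp only [Zop, Dplus_union]; rfl

/-- An open inside `Z_s` and `Z_t` is inside `Z_{s ∪ t}`. [folklore] -/
theorem le_Zop_union {s t : Finset (Fin (r + 1))} {V : Z.Opens} (hs : V ≤ Zop ι s) (ht : V ≤ Zop ι t) :
    V ≤ Zop ι (s ∪ t) := by
  rw [Zop_union]; exact le_inf hs ht

/-! ## Restriction bookkeeping -/

omit ι in
/-- Restricting along equal inequalities (proof irrelevance helper for rewriting). [folklore] -/
theorem map_congr {U V : Z.Opens} (h h' : V ≤ U) (s : Γ(Z, U)) :
    Z.presheaf.map (homOfLE h).op s = Z.presheaf.map (homOfLE h').op s := rfl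

/-- A chart function restricted to `V ⊆ Z_j` factors through any larger chart set `s ∋ j` with
`V ⊆ Z_s`: `(x_i/x_j)|_V = (evalRing s (t_{{i},j}))|_V` (in the `Sections` language of the tree's Čech
files, where `Sections.res` is an algebra homomorphism). [folklore] -/
theorem res_chartFun_eq {i j : Fin (r + 1)} {s : Finset (Fin (r + 1))} (hjs : ({j} : Finset (Fin (r + 1))) ⊆ s)
    {V : Z.Opens} (hj : V ≤ Zop ι {j}) (hs : V ≤ Zop ι s) :
    Sections.res (strZ ι) hj (show Sections (strZ ι) (Zop ι {j}) from chartFun ι i j) =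
      Sections.res (strZ ι) hs (evalRing ι s ⟨tEl A {i} j, Bsub_mono hjs (tEl_mem {i} j)⟩) := by
  have e := evalRing_res ι hjs (tElB A {i} j)
  change Sections.res (strZ ι) hj (evalRing ι {j} (tElB A {i} j)) =
    Sections.res (strZ ι) hs (evalRing ι s ⟨(tElB A {i} j : L A r), Bsub_mono hjs (tElB A {i} j).2⟩)
  rw [e, Sections.res_res]

/-! ## The cocycle identities of the chart functions -/

omit ι in
/-- In the Laurent ring: `x_i/x_j = (x_i/x_{j'}) (x_{j'}/x_j)`. [folklore] -/
theorem tEl_singleton_cocycle (i j j' : Fin (r + 1)) :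
    tEl A ({i} : Finset (Fin (r + 1))) j = tEl A ({i} : Finset (Fin (r + 1))) j' * tEl A ({j'} : Finset (Fin (r + 1))) j := by
  rw [tEl_singleton, tEl_singleton, tEl_singleton]
  calc xs A {i} 1 * xs A {j} (-1) = xs A {i} 1 * (xs A {j'} (-1) * xs A {j'} 1) * xs A {j} (-1) := by
        rw [xs_neg_mul_xs, mul_one]
    _ = _ := by ring

/-- **The cocycle identity** `x_i / x_j = (x_i / x_{j'}) · (x_{j'} / x_j)` on `V ⊆ Z_j ∩ Z_{j'}`. [folklore] -/
theorem chartFun_cocycle (i j j' : Fin (r + 1)) {V : Z.Opens} (hj : V ≤ Zop ι {j}) (hj' : V ≤ Zop ι {j'}) :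
    Z.presheaf.map (homOfLE hj).op (chartFun ι i j) =
      Z.presheaf.map (homOfLE hj').op (chartFun ι i j') * Z.presheaf.map (homOfLE hj).op (chartFun ι j' j) := by
  have hs : V ≤ Zop ι ({j} ∪ {j'}) := le_Zop_union ι hj hj'
  have h₁ : ({j} : Finset (Fin (r + 1))) ⊆ {j} ∪ {j'} := Finset.subset_union_left
  have h₂ : ({j'} : Finset (Fin (r + 1))) ⊆ {j} ∪ {j'} := Finset.subset_union_right
  have key : Sections.res (strZ ι) hs (evalRing ι _ ⟨tEl A {i} j, Bsub_mono h₁ (tEl_mem {i} j)⟩) =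
      Sections.res (strZ ι) hs (evalRing ι _ ⟨tEl A {i} j', Bsub_mono h₂ (tEl_mem {i} j')⟩) *
        Sections.res (strZ ι) hs (evalRing ι _ ⟨tEl A {j'} j, Bsub_mono h₁ (tEl_mem {j'} j)⟩) := by
    rw [← map_mul, ← map_mul]
    exact congrArg _ (congrArg _ (Subtype.ext (tEl_singleton_cocycle i j j')))
  calc Z.presheaf.map (homOfLE hj).op (chartFun ι i j)
      = Sections.res (strZ ι) hj (show Sections (strZ ι) (Zop ι {j}) from chartFun ι i j) := rfl
    _ = _ := res_chartFun_eq ι h₁ hj hs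
    _ = _ := key
    _ = Sections.res (strZ ι) hj' (show Sections (strZ ι) (Zop ι {j'}) from chartFun ι i j') *
          Sections.res (strZ ι) hj (show Sections (strZ ι) (Zop ι {j}) from chartFun ι j' j) := by
        rw [res_chartFun_eq ι h₂ hj' hs, res_chartFun_eq ι h₁ hj hs]
    _ = _ := rfl

/-- `(x_j / x_{j'}) · (x_{j'} / x_j) = 1` on `V ⊆ Z_j ∩ Z_{j'}`. [folklore] -/
theorem chartFun_mul_symm (j j' : Fin (r + 1)) {V : Z.Opens} (hj : V ≤ Zop ι {j}) (hj' : V ≤ Zop ι {j'}) :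
    Z.presheaf.map (homOfLE hj').op (chartFun ι j j') * Z.presheaf.map (homOfLE hj).op (chartFun ι j' j) = 1 := by
  rw [← chartFun_cocycle ι j j j' hj hj', chartFun_self, map_one]

/-- **Change of chart for the word functions**: `μ_w / x_j^m = (μ_w / x_{j'}^m) · (x_{j'} / x_j)^m` on
`V ⊆ Z_j ∩ Z_{j'}`. [folklore] -/
theorem wordFun_cocycle {m : ℕ} (w : Fin m → Fin (r + 1)) (j j' : Fin (r + 1)) {V : Z.Opens}
    (hj : V ≤ Zop ι {j}) (hj' : V ≤ Zop ι {j'}) :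
    Z.presheaf.map (homOfLE hj).op (wordFun ι j w) =
      Z.presheaf.map (homOfLE hj').op (wordFun ι j' w) * Z.presheaf.map (homOfLE hj).op (chartFun ι j' j) ^ m := by
  rw [wordFun, wordFun, map_prod, map_prod]
  calc ∏ t, Z.presheaf.map (homOfLE hj).op (chartFun ι (w t) j)
      = ∏ t, (Z.presheaf.map (homOfLE hj').op (chartFun ι (w t) j') *
          Z.presheaf.map (homOfLE hj).op (chartFun ι j' j)) :=
        Finset.prod_congr rfl fun t _ => chartFun_cocycle ι (w t) j j' hj hj'
    _ = _ := by rw [Finset.prod_mul_distrib, Finset.prod_const, Finset.card_univ, Fintype.card_fin]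

/-- **The key symmetric identity**: `(μ_w / x_j^m)(μ_{w'} / x_{j'}^m) = (μ_{w'} / x_j^m)(μ_w / x_{j'}^m)` on
`V ⊆ Z_j ∩ Z_{j'}` (so the local generators of `𝒪_Z(-m)` on different charts are proportional). [folklore] -/
theorem wordFun_mul_comm {m : ℕ} (w w' : Fin m → Fin (r + 1)) (j j' : Fin (r + 1)) {V : Z.Opens}
    (hj : V ≤ Zop ι {j}) (hj' : V ≤ Zop ι {j'}) :
    Z.presheaf.map (homOfLE hj).op (wordFun ι j w) * Z.presheaf.map (homOfLE hj').op (wordFun ι j' w') =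
      Z.presheaf.map (homOfLE hj).op (wordFun ι j w') * Z.presheaf.map (homOfLE hj').op (wordFun ι j' w) := by
  rw [wordFun_cocycle ι w j j' hj hj', wordFun_cocycle ι w' j j' hj hj']
  ring

/-! ## Local sections and the local generator -/

/-- For `c ∈ Γ(Z, V)` with `V ⊆ Z_j`, the family `(c · μ_w / x_j^m)_w` is a section of `𝒪_Z(-m)` over `V`.
[folklore] -/
theorem isTwistSection_mul_wordFun {m : ℕ} {j : Fin (r + 1)} {V : Z.Opens} (hj : V ≤ Zop ι {j})
    (c : Γ(Z, V)) : IsTwistSection ι m V fun w => c * Z.presheaf.map (homOfLE hj).op (wordFun ι j w) := by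
  intro j' w w' V' hV' hj'
  rw [map_mul, map_mul, IsTwistSection.map_map_apply, IsTwistSection.map_map_apply, mul_assoc, mul_assoc,
    map_congr (hV'.trans hj) (hV'.trans hj), wordFun_mul_comm ι w w' j j' (hV'.trans hj) hj']

/-- **The local generator `v_j ∈ Γ(Z_j, 𝒪_Z(-m))`**, `(v_j)_w = μ_w / x_j^m` (Hartshorne II.5.12: the
trivialising section of `𝒪(-m)` on `D₊(x_j)`). [folklore] -/
def gen (m : ℕ) (j : Fin (r + 1)) : Γ(serreTwist ι m, Zop ι {j}) :=
  mkSection ι (fun w => wordFun ι j w) (by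
    have h := isTwistSection_mul_wordFun ι (m := m) (le_refl (Zop ι {j})) 1
    simp only [one_mul] at h
    refine fun j' w w' V hV hj' => ?_
    have key := h j' w w' hV hj'
    simp only [IsTwistSection.map_map_apply] at key
    exact key)

/-- Components of the local generator. [folklore] -/
@[simp]
theorem coeff_gen (m : ℕ) (j : Fin (r + 1)) (w : Fin m → Fin (r + 1)) : coeff ι (gen ι m j) w = wordFun ι j w := rfl

/-- The `j⋯j`-component of the local generator `v_j` is `1`. [folklore] -/
theorem coeff_gen_const (m : ℕ) (j : Fin (r + 1)) : coeff ι (gen ι m j) (fun _ => j) = 1 :=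
  wordFun_const ι j m

omit ι in
/-- Restriction along `le_rfl` is the identity on sections of a scheme's module. [folklore] -/
theorem map_id_apply (M : Z.Modules) {V : Z.Opens} (s : Γ(M, V)) : M.presheaf.map (homOfLE le_rfl).op s = s := by
  have : (homOfLE (le_refl V)).op = 𝟙 (op V) := Subsingleton.elim _ _
  rw [this, M.presheaf.map_id]; rfl

/-- **Local description of the sections of `𝒪_Z(-m)`**: over `V ⊆ Z_j`, `f_w = f_{j⋯j} · (μ_w / x_j^m)|_V`.
[folklore] -/
theorem coeff_eq_coeff_const_mul {m : ℕ} {j : Fin (r + 1)} {V : Z.Opens} (hj : V ≤ Zop ι {j})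
    (f : Γ(serreTwist ι m, V)) (w : Fin m → Fin (r + 1)) :
    coeff ι f w = coeff ι f (fun _ => j) * Z.presheaf.map (homOfLE hj).op (wordFun ι j w) := by
  have key := (isTwistSection_coeff ι f).apply_eq_mul_wordFun (le_refl V) hj w
  have h1 : Z.presheaf.map (homOfLE (le_refl V)).op (coeff ι f w) = coeff ι f w :=
    map_id_apply (SheafOfModules.unit _) (coeff ι f w)
  have h2 : Z.presheaf.map (homOfLE (le_refl V)).op (coeff ι f fun _ => j) = coeff ι f fun _ => j :=
    map_id_apply (SheafOfModules.unit _) _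
  rwa [h1, h2] at key

/-- Over `V ⊆ Z_j`, every section is its `j⋯j`-component times the restricted local generator:
`f = f_{j⋯j} · v_j|_V`. [folklore] -/
theorem eq_smul_gen {m : ℕ} {j : Fin (r + 1)} {V : Z.Opens} (hj : V ≤ Zop ι {j}) (f : Γ(serreTwist ι m, V)) :
    f = coeff ι f (fun _ => j) • (serreTwist ι m).presheaf.map (homOfLE hj).op (gen ι m j) := by
  ext w
  rw [coeff_smul, coeff_map, coeff_gen]
  exact coeff_eq_coeff_const_mul ι hj f w

/-- Over `V ⊆ Z_j`, a section of `𝒪_Z(-m)` is determined by its `j⋯j`-component. [folklore] -/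
theorem coeff_const_injective {m : ℕ} {j : Fin (r + 1)} {V : Z.Opens} (hj : V ≤ Zop ι {j})
    {f g : Γ(serreTwist ι m, V)} (h : coeff ι f (fun _ => j) = coeff ι g (fun _ => j)) : f = g := by
  rw [eq_smul_gen ι hj f, eq_smul_gen ι hj g, h]

/-- The section `c · v_j|_V` has `j⋯j`-component `c`. [folklore] -/
theorem coeff_smul_map_gen_const {m : ℕ} {j : Fin (r + 1)} {V : Z.Opens} (hj : V ≤ Zop ι {j}) (c : Γ(Z, V)) :
    coeff ι (c • (serreTwist ι m).presheaf.map (homOfLE hj).op (gen ι m j)) (fun _ => j) = c := by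
  rw [coeff_smul, coeff_map, coeff_gen, wordFun_const, map_one, mul_one]

/-- **The transition functions of `𝒪_Z(-m)`**: `v_j|_V = (x_{j'}/x_j)^m|_V · v_{j'}|_V` on `V ⊆ Z_j ∩ Z_{j'}`
(Hartshorne II.5.12). [folklore] -/
theorem gen_restrict_eq_smul_gen {m : ℕ} (j j' : Fin (r + 1)) {V : Z.Opens} (hj : V ≤ Zop ι {j})
    (hj' : V ≤ Zop ι {j'}) :
    (serreTwist ι m).presheaf.map (homOfLE hj).op (gen ι m j) =
      Z.presheaf.map (homOfLE hj).op (chartFun ι j' j) ^ m •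
        (serreTwist ι m).presheaf.map (homOfLE hj').op (gen ι m j') := by
  ext w
  rw [coeff_map, coeff_gen, coeff_smul, coeff_map, coeff_gen, mul_comm]
  exact wordFun_cocycle ι w j j' hj hj'

/-! ## Multiplication by a variable on the charts -/

/-- On `V ⊆ Z_j`, multiplication by `x_l` multiplies the `j⋯j`-coordinate by `x_l / x_j`:
`(x_l · f)_{j⋯j} = (x_l/x_j)|_V · f_{j⋯j}`. [folklore] -/
theorem coeff_const_mulX {m : ℕ} (l j : Fin (r + 1)) {V : Z.Opens} (hj : V ≤ Zop ι {j})
    (f : Γ(serreTwist ι (m + 1), V)) :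
    coeff ι ((mulX ι m l).app V f) (fun _ => j) =
      Z.presheaf.map (homOfLE hj).op (chartFun ι l j) * coeff ι f (fun _ => j) := by
  rw [coeff_mulX_app, coeff_eq_coeff_const_mul ι hj f (Fin.cons l fun _ => j), wordFun_cons, wordFun_const,
    mul_one, mul_comm]

/-- On `V ⊆ Z_l`, multiplication by `x_l` does not change the `l⋯l`-coordinate: it is the identity in the
trivialisation of `Z_l` (so `x_l : 𝒪_Z(-(m+1)) → 𝒪_Z(-m)` is an isomorphism over `Z_l`). [folklore] -/
theorem coeff_const_mulX_self {m : ℕ} (l : Fin (r + 1)) {V : Z.Opens} (hl : V ≤ Zop ι {l})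
    (f : Γ(serreTwist ι (m + 1), V)) :
    coeff ι ((mulX ι m l).app V f) (fun _ => l) = coeff ι f (fun _ => l) := by
  rw [coeff_const_mulX ι l l hl, chartFun_self, map_one, one_mul]

/-- Multiplication by `x_l` is injective on sections over `V ⊆ Z_l`. [folklore] -/
theorem mulX_app_injective_of_le {m : ℕ} (l : Fin (r + 1)) {V : Z.Opens} (hl : V ≤ Zop ι {l}) :
    Function.Injective ((mulX ι m l).app V) := fun f g h => by
  apply coeff_const_injective ι hl
  rw [← coeff_const_mulX_self ι l hl f, ← coeff_const_mulX_self ι l hl g, h]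

/-- Multiplication by `x_l` is surjective on sections over `V ⊆ Z_l`: `c · v_l^{(m)}|_V` is the image of
`c · v_l^{(m+1)}|_V`. [folklore] -/
theorem mulX_app_surjective_of_le {m : ℕ} (l : Fin (r + 1)) {V : Z.Opens} (hl : V ≤ Zop ι {l}) :
    Function.Surjective ((mulX ι m l).app V) := fun g => by
  refine ⟨coeff ι g (fun _ => l) • (serreTwist ι (m + 1)).presheaf.map (homOfLE hl).op (gen ι (m + 1) l), ?_⟩
  apply coeff_const_injective ι hl
  rw [coeff_const_mulX_self ι l hl, coeff_smul_map_gen_const]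

end SerreTwist

end Literature.AlgebraicGeometry.Modules

end
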